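import Mathlib
import Summits.Parity.GeneralizedHardyLittlewood.Theses.LiouvilleMAD

/-!
# The umbrella `CorrelationNoiseLaw` of crux idea `lag-window-normal-form` is false as stated

Crux `FanDecorrelation` (`Summit.Parity.GeneralizedHardyLittlewood.Theses.LiouvilleMAD`,
stmt-Parity-13318).  The crux-idea card `lag-window-normal-form` (ideator 1; sketch
`Cruxes/FanDecorrelation/SketchIdeator1.lean`) offers, besides its transfer
`C⁺ = LagWindowLaw δ ∧ WindowedCosetLaw δ`, an UMBRELLA law `CorrelationNoiseLaw` ("the two-point
correlation sequence `h ↦ D(h)` of the pair `(λ(n·+c), λ(n'·+c))` is `M^κ`-pseudorandom along every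
progression of lags, in every window of at most `M^{1−2κ}` lags, at every frequency"), with the
kernel-checked assembly `mad_of_noise : CorrelationNoiseLaw → CosetDecorrelation ∧ FanDecorrelation`.

This file records that `CorrelationNoiseLaw` is FALSE: the law lets the lag window sit ANYWHERE,
in particular at the one fully biased ("proportional") lag of the pair, which the crux's own fan
window `[Q, 2Q)·k` never contains (`|h| ≤ |c| < Q`, the disprover's `proportional_lag_small`).
Witness: shift `c = 2`, dilations `(n, n') = (2, 1)`, decimation `k = 1`, window `[1, 2)` (the
single lag `h = 1`), frequency `θ = 0`.  Then `λ(2(m'+1) + 2)·λ(m' + 2) = λ(2)·λ(m'+2)² = −1` for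
every `m'`, so `D(1) = −(M − 1)` exactly (`lagCorr_two_two_one`), while the law asks
`|D(1)| ≤ C·M^{1−κ}` with `κ > 0` — impossible for large `M` (`not_correlationNoiseLaw`).

REPAIR (information for planners; not asserted here): restrict the windows to lags `≥ Q` in
absolute value (as the crux and both laws of `C⁺` do), or to windows avoiding `|h| ≤ |c|`; the
witness then disappears and the repaired umbrella is again random-model consistent.

The definition `lagCorr` below and the negated statement of `not_correlationNoiseLaw` are VERBATIM
copies of `Summit.Parity.GeneralizedHardyLittlewood.Cruxes.FanDecorrelation.LagWindow.lagCorr` /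
`.CorrelationNoiseLaw` (SketchIdeator1.lean, lines 38–42 and 195–201), which live in a crux work
file that is not an importable module (so `¬ LagWindow.CorrelationNoiseLaw` follows by `Iff.rfl`
transport wherever that file is in scope).
-/

namespace Summit.Parity.GeneralizedHardyLittlewood.Theorems.FanDecorrelation.CorrelationNoiseLawFalse

open ArithmeticFunction Filter

noncomputable section

/-- The two-point (dilated, two-shift) correlation at lag `h`:
`D(h) = Σ_{(m,m') ∈ (M,2M]², m − m' = h} λ(mn+c) λ(m'n'+c)` (verbatim copy of
`LagWindow.lagCorr`). -/
def lagCorr (c : ℤ) (n n' M : ℕ) (h : ℤ) : ℝ :=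
  ∑ p ∈ (Finset.Ioc M (2 * M) ×ˢ Finset.Ioc M (2 * M)).filter
      (fun p : ℕ × ℕ => (p.1 : ℤ) - p.2 = h),
    (ArithmeticFunction.liouville (Int.toNat ((p.1 : ℤ) * n + c)) : ℝ) *
      (ArithmeticFunction.liouville (Int.toNat ((p.2 : ℤ) * n' + c)) : ℝ)

theorem liouville_mul_of_ne_zero {a b : ℕ} (ha : a ≠ 0) (hb : b ≠ 0) :
    liouville (a * b) = liouville a * liouville b := by
  rw [liouville_apply (mul_ne_zero ha hb), liouville_apply ha, liouville_apply hb,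
    cardFactors_mul ha hb, pow_add]

theorem liouville_two : liouville 2 = -1 := by
  rw [liouville_apply two_ne_zero, cardFactors_apply_prime Nat.prime_two]; norm_num

theorem liouville_sq_cast {t : ℕ} (ht : t ≠ 0) :
    (liouville t : ℝ) * (liouville t : ℝ) = 1 := by
  rw [liouville_apply ht]; push_cast
  rw [← pow_add, ← two_mul, pow_mul]; norm_num

/-- At `(c, n, n') = (2, 2, 1)` and lag `1` every term of `D(1)` is `−1`:
`λ((m'+1)·2 + 2)·λ(m'·1 + 2) = λ(2(m'+2))·λ(m'+2) = λ(2)·λ(m'+2)² = −1`. [folklore] -/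
theorem term_eq_neg_one (M : ℕ) :
    ∀ p ∈ (Finset.Ioc M (2 * M) ×ˢ Finset.Ioc M (2 * M)).filter
        (fun p : ℕ × ℕ => (p.1 : ℤ) - p.2 = 1),
      (liouville (Int.toNat ((p.1 : ℤ) * ((2 : ℕ) : ℤ) + 2)) : ℝ) *
        (liouville (Int.toNat ((p.2 : ℤ) * ((1 : ℕ) : ℤ) + 2)) : ℝ) = -1 := by
  intro p hp
  rw [Finset.mem_filter, Finset.mem_product, Finset.mem_Ioc, Finset.mem_Ioc] at hp
  obtain ⟨_, heq⟩ := hp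
  have hp1 : p.1 = p.2 + 1 := by omega
  have e1 : Int.toNat ((p.1 : ℤ) * ((2 : ℕ) : ℤ) + 2) = 2 * (p.2 + 2) := by
    have : ((p.1 : ℤ) * ((2 : ℕ) : ℤ) + 2) = ((2 * (p.2 + 2) : ℕ) : ℤ) := by
      rw [hp1]; push_cast; ring
    rw [this, Int.toNat_natCast]
  have e2 : Int.toNat ((p.2 : ℤ) * ((1 : ℕ) : ℤ) + 2) = p.2 + 2 := by
    have : ((p.2 : ℤ) * ((1 : ℕ) : ℤ) + 2) = ((p.2 + 2 : ℕ) : ℤ) := by push_cast; ring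
    rw [this, Int.toNat_natCast]
  rw [e1, e2, liouville_mul_of_ne_zero two_ne_zero (by omega : p.2 + 2 ≠ 0), liouville_two]
  have hsq := liouville_sq_cast (t := p.2 + 2) (by omega)
  push_cast
  linear_combination (-1 : ℝ) * hsq

/-- The lag-`1` slice of `(M,2M]²` is in bijection with `(M, 2M−1]` via `m' ↦ (m'+1, m')`, so it
has `M − 1` elements. [folklore] -/
theorem card_filter_lag_one (M : ℕ) :
    ((Finset.Ioc M (2 * M) ×ˢ Finset.Ioc M (2 * M)).filter
        (fun p : ℕ × ℕ => (p.1 : ℤ) - p.2 = 1)).card = M - 1 := by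
  have h := Finset.card_nbij' (s := (Finset.Ioc M (2 * M) ×ˢ Finset.Ioc M (2 * M)).filter
        (fun p : ℕ × ℕ => (p.1 : ℤ) - p.2 = 1)) (t := Finset.Ioc M (2 * M - 1))
      (fun p : ℕ × ℕ => p.2) (fun m : ℕ => (m + 1, m)) ?_ ?_ ?_ ?_
  · rw [h, Nat.card_Ioc]; omega
  · intro p hp
    simp only [Finset.mem_coe, Finset.mem_filter, Finset.mem_product, Finset.mem_Ioc] at hp ⊢
    omega
  · intro m hm
    rw [Finset.mem_coe, Finset.mem_Ioc] at hm
    rw [Finset.mem_coe, Finset.mem_filter, Finset.mem_product, Finset.mem_Ioc, Finset.mem_Ioc]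
    refine ⟨⟨⟨?_, ?_⟩, ?_, ?_⟩, ?_⟩ <;> simp only <;> omega
  · intro p hp
    rw [Finset.mem_coe, Finset.mem_filter, Finset.mem_product, Finset.mem_Ioc,
      Finset.mem_Ioc] at hp
    ext
    · simp only; omega
    · rfl
  · intro m _
    rfl

/-- **Exact value of the biased lag**: `D(1) = −(M − 1)` at `(c, n, n') = (2, 2, 1)`, `M ≥ 1`.
[folklore] -/
theorem lagCorr_two_two_one (M : ℕ) (hM : 1 ≤ M) : lagCorr 2 2 1 M 1 = -((M : ℝ) - 1) := by
  unfold lagCorr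
  rw [Finset.sum_congr rfl (term_eq_neg_one M), Finset.sum_const, card_filter_lag_one M,
    nsmul_eq_mul, Nat.cast_sub hM]
  push_cast
  ring

/-- **The umbrella law `CorrelationNoiseLaw` of card `lag-window-normal-form` is false.**  The
negated statement is, verbatim, `LagWindow.CorrelationNoiseLaw` (SketchIdeator1.lean:195–201):
for every `c ≠ 0` some `κ ∈ (0, 1/4)` and `C` bound EVERY twisted window sum
`‖Σ_{i ∈ [L₁,L₂)} D(k i) e(θ i)‖ ≤ C·M^{1−κ}` over windows of `≤ M^{1−2κ}` lags, uniformly in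
`1 ≤ n ≠ n' ≤ 2M`, `k ≥ 1`.  Witness `c = 2`, `(n, n') = (2, 1)`, `k = 1`, window `[1, 2)`,
`θ = 0`: the window sum is `D(1) = −(M−1)` (`lagCorr_two_two_one`), of modulus `M − 1`, which
exceeds `C·M^{1−κ}` as soon as `M^κ > 2|C|` and `M ≥ 2`. [folklore] -/
theorem not_correlationNoiseLaw :
    ¬ (∀ c : ℤ, c ≠ 0 → ∃ κ : ℝ, 0 < κ ∧ κ < 1 / 4 ∧ ∃ C : ℝ, ∀ M n n' k : ℕ, ∀ L₁ L₂ : ℤ,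
        ∀ θ : ℝ, 1 ≤ n → 1 ≤ n' → n ≠ n' → n ≤ 2 * M → n' ≤ 2 * M → 1 ≤ k →
          ((L₂ - L₁ : ℤ) : ℝ) ≤ (M : ℝ) ^ (1 - 2 * κ) →
            ‖∑ i ∈ Finset.Ico L₁ L₂,
                (lagCorr c n n' M ((k : ℤ) * i) : ℂ) *
                  Complex.exp (2 * Real.pi * Complex.I * θ * i)‖ ≤ C * (M : ℝ) ^ (1 - κ)) := by
  intro h
  obtain ⟨κ, hκ, hκ4, C, hC⟩ := h 2 two_ne_zero
  have ht : Tendsto (fun M : ℕ => (M : ℝ) ^ κ) atTop atTop :=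
    (tendsto_rpow_atTop hκ).comp tendsto_natCast_atTop_atTop
  obtain ⟨M, hM2, hMC⟩ :=
    ((eventually_ge_atTop 2).and (ht.eventually_gt_atTop (2 * |C|))).exists
  have hM2' : (2 : ℝ) ≤ M := by exact_mod_cast hM2
  have hx : (0 : ℝ) < M := by linarith
  have hx1 : (1 : ℝ) ≤ M := by linarith
  have key := hC M 2 1 1 1 2 0 (by norm_num) le_rfl (by norm_num) (by omega) (by omega) le_rfl
    (by
      have : (1 : ℝ) ≤ (M : ℝ) ^ (1 - 2 * κ) := Real.one_le_rpow hx1 (by linarith)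
      push_cast; linarith)
  have hIco : Finset.Ico (1 : ℤ) 2 = {1} := by
    ext x; simp only [Finset.mem_Ico, Finset.mem_singleton]; omega
  rw [hIco, Finset.sum_singleton] at key
  simp only [Nat.cast_one, Complex.ofReal_zero, mul_zero, Complex.exp_zero,
    mul_one, Complex.norm_real, Real.norm_eq_abs, Int.cast_one] at key
  rw [lagCorr_two_two_one M (by omega), abs_neg,
    abs_of_nonneg (by linarith : (0 : ℝ) ≤ (M : ℝ) - 1)] at key
  -- `key : M - 1 ≤ C * M^(1-κ)`; compare with `M = M^κ · M^(1-κ) > 2|C| · M^(1-κ)`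
  have hup : C * (M : ℝ) ^ (1 - κ) ≤ |C| * (M : ℝ) ^ (1 - κ) :=
    mul_le_mul_of_nonneg_right (le_abs_self C) (by positivity)
  have hsplit : (M : ℝ) = (M : ℝ) ^ κ * (M : ℝ) ^ (1 - κ) := by
    rw [← Real.rpow_add hx, show κ + (1 - κ) = 1 by ring, Real.rpow_one]
  have hpos : (0 : ℝ) < (M : ℝ) ^ (1 - κ) := Real.rpow_pos_of_pos hx _
  have h3 : 2 * |C| * (M : ℝ) ^ (1 - κ) < (M : ℝ) ^ κ * (M : ℝ) ^ (1 - κ) :=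
    mul_lt_mul_of_pos_right hMC hpos
  rw [← hsplit] at h3
  linarith

end

end Summit.Parity.GeneralizedHardyLittlewood.Theorems.FanDecorrelation.CorrelationNoiseLawFalse
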